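import Summits.Ventures.PercRepro.BKInequality

/-!
# The van den Berg–Kesten inequality for decreasing events

Complementing every edge (`flipAll`) exchanges the laws `p` and `1 - p` (`weight_flipAll`,
`prob_flipAll`), turns decreasing events into increasing ones and preserves witnesses and the
disjoint occurrence (`witness_flipAll_iff`, `disjointOccurrence_flipAll`).  Hence the BK
inequality for increasing events (`bk`) gives it for decreasing events (`bk_lower`):
`P(A □ B) ≤ P(A) · P(B)` for `A`, `B` decreasing.
-/

namespace PercRepro

open Finset

variable {E : Type*}

/-- Complementing every edge. -/
def flipAll (ω : Config E) : Config E := fun e => !ω e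

/-- `flipAll` is an involution. -/
theorem flipAll_flipAll (ω : Config E) : flipAll (flipAll ω) = ω := by
  funext e; simp [flipAll]

/-- `flipAll` is an involution. -/
theorem flipAll_involutive : Function.Involutive (flipAll : Config E → Config E) :=
  flipAll_flipAll

/-- `flipAll` reverses the order. -/
theorem flipAll_antitone {ω ω' : Config E} (h : ω ≤ ω') : flipAll ω' ≤ flipAll ω := by
  intro e
  have := h e
  simp only [flipAll]
  cases hω : ω e <;> cases hω' : ω' e <;> simp_all

/-- The law `1 - p`. -/
def oneSub (p : E → ℝ) : E → ℝ := fun e => 1 - p e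

/-- `1 - p` is a probability vector when `p` is. -/
theorem isProb_oneSub {p : E → ℝ} (hp : IsProb p) : IsProb (oneSub p) := by
  intro e
  have := hp e
  unfold oneSub
  constructor <;> linarith [this.1, this.2]

variable [Fintype E] [DecidableEq E]

omit [DecidableEq E] in
/-- The weight of the complemented configuration under `p` is the weight under `1 - p`. -/
theorem weight_flipAll (p : E → ℝ) (ω : Config E) :
    weight p (flipAll ω) = weight (oneSub p) ω := by
  unfold weight oneSub
  refine Finset.prod_congr rfl fun e _ => ?_
  simp only [flipAll]
  by_cases h : ω e = true <;> simp [h]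

/-- `P_p(A) = P_{1-p}(flipAll ⁻¹' A)`. -/
theorem prob_flipAll (p : E → ℝ) (A : Set (Config E)) :
    prob p A = prob (oneSub p) (flipAll ⁻¹' A) := by
  unfold prob
  rw [← (flipAll_involutive (E := E)).bijective.sum_comp]
  refine Finset.sum_congr rfl fun ω _ => ?_
  by_cases h : flipAll ω ∈ A
  · rw [Set.indicator_of_mem h, Set.indicator_of_mem (Set.mem_preimage.mpr h), weight_flipAll]
  · rw [Set.indicator_of_notMem h, Set.indicator_of_notMem (fun h' => h (Set.mem_preimage.mp h'))]

omit [Fintype E] [DecidableEq E] in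
/-- The preimage of a decreasing event under `flipAll` is increasing. -/
theorem isUpperSet_preimage_flipAll {A : Set (Config E)} (hA : IsLowerSet A) :
    IsUpperSet (flipAll ⁻¹' A) :=
  fun _ _ h hω => hA (flipAll_antitone h) hω

omit [Fintype E] [DecidableEq E] in
/-- Witnesses are preserved by complementation. -/
theorem witness_flipAll_iff {A : Set (Config E)} {I : Set E} {ω : Config E} :
    Witness (flipAll ⁻¹' A) I (flipAll ω) ↔ Witness A I ω := by
  constructor
  · intro h ω' hω'
    have : flipAll ω' ∈ flipAll ⁻¹' A := h (flipAll ω') fun e he => by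
      simp only [flipAll]; rw [hω' e he]
    simpa [flipAll_flipAll] using this
  · intro h ω' hω'
    have : flipAll ω' ∈ A := h (flipAll ω') fun e he => by
      have := hω' e he
      simp only [flipAll] at this ⊢
      rw [this]; simp
    exact this

omit [Fintype E] [DecidableEq E] in
/-- Witnesses are preserved by complementation (the other form). -/
theorem witness_preimage_flipAll_iff {A : Set (Config E)} {I : Set E} {ω : Config E} :
    Witness (flipAll ⁻¹' A) I ω ↔ Witness A I (flipAll ω) := by
  conv_lhs => rw [← flipAll_flipAll ω]
  exact witness_flipAll_iff

omit [Fintype E] [DecidableEq E] in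
/-- The disjoint occurrence is preserved by complementation. -/
theorem disjointOccurrence_flipAll (A B : Set (Config E)) :
    flipAll ⁻¹' DisjointOccurrence A B = DisjointOccurrence (flipAll ⁻¹' A) (flipAll ⁻¹' B) := by
  ext ω
  simp only [Set.mem_preimage, DisjointOccurrence, Set.mem_setOf_eq, witness_preimage_flipAll_iff]

/-- **The van den Berg–Kesten inequality for decreasing events**:
`P(A □ B) ≤ P(A) · P(B)` for `A`, `B` decreasing. -/
theorem bk_lower {p : E → ℝ} (hp : IsProb p) {A B : Set (Config E)} (hA : IsLowerSet A)
    (hB : IsLowerSet B) :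
    prob p (DisjointOccurrence A B) ≤ prob p A * prob p B := by
  rw [prob_flipAll p (DisjointOccurrence A B), prob_flipAll p A, prob_flipAll p B,
    disjointOccurrence_flipAll A B]
  exact bk (isProb_oneSub hp) (isUpperSet_preimage_flipAll hA) (isUpperSet_preimage_flipAll hB)

end PercRepro
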